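import Summits.ValiantsHypothesis.ValiantsHypothesis.Theorems.KPlusLogSqLawStaticPathFold

/-!
# Route «KPlusLogSqLaw» — the ALTERNATING FOLD LEMMA, part 2: run suprema and the count

HONEST FRAMING.  Second half of the degeneracy-free fold lemma (part 1: `KPlusLogSqLawStaticPathFold.lean`; definitions:
`KPlusLogSqLawStaticPathFoldDefs.lean`), a helper toward the crux `WeakLifting` (item `stmt-ValiantsHypothesis-19561`, route
`KPlusLogSqLaw`, cell `pub-symmetroid`, seat val-sym-lift-p3 g6, 2026-08-27) on the line of its witness-plan stub
`stub_tridiagonalSectorB` (tropical twin of the STATIC tridiagonal sector = parametric max-weight matching on a path, val-sym-lift-p4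
g6 `HOME/val-sym-lift-p4/STATIC-PATH-NLOGN.md`, whose Theorem P2 this is, WITHOUT its general-position hypothesis and with a weaker
constant).  `sSup_run_mem`: the supremum of a run of active index `j` of the alternating fold of `n + 1` pairwise-distinct lines lies
in the endpoint set `B n` (infima / suprema of the intervals `I n j`, `T n j`); `card_changes_le`: hence the active index changes at
most `8 n + 9` times along any strictly increasing parameter sequence.  A statement about `n + 1` lines; nothing here asserts anything
about `WeakLifting`, `TropicalB`, `KPlusLogSqLaw`, the stub in its window, `MatrixDescartes` (stmt-ValiantsHypothesis-18050) or `VP ≠ VNP`.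
-/

set_option linter.dupNamespace false
set_option autoImplicit false

namespace Summit.ValiantsHypothesis.ValiantsHypothesis.Theorems.KPlusLogSqLaw

open Set Classical

namespace StaticPathFold

noncomputable section

variable (a b : ℕ → ℝ)

/-! ## 3. The run-supremum lemma -/

/-- **run-supremum lemma.**  If the active index is `j` at `θ₁` and not `j` at `θ₂ > θ₁`, then the supremum of the
parameters in `[θ₁, θ₂]` with active index `j` lies in the endpoint set `B n` (and in `[θ₁, θ₂]`).  Requires the lines of
index `≤ n` to be pairwise distinct. -/
theorem sSup_run_mem (n : ℕ) (hd : ∀ i j, i < j → j ≤ n → (a i ≠ a j ∨ b i ≠ b j)) {θ₁ θ₂ : ℝ} (h12 : θ₁ < θ₂)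
    {j : ℕ} (hj1 : lab a b n θ₁ = j) (hj2 : lab a b n θ₂ ≠ j) :
    sSup {τ | τ ∈ Icc θ₁ θ₂ ∧ lab a b n τ = j} ∈ B a b n ∧
      θ₁ ≤ sSup {τ | τ ∈ Icc θ₁ θ₂ ∧ lab a b n τ = j} ∧ sSup {τ | τ ∈ Icc θ₁ θ₂ ∧ lab a b n τ = j} ≤ θ₂ := by
  set A : Set ℝ := {τ | τ ∈ Icc θ₁ θ₂ ∧ lab a b n τ = j} with hA
  have hjn : j ≤ n := hj1 ▸ lab_le a b n θ₁
  have hne : A.Nonempty := ⟨θ₁, ⟨le_rfl, h12.le⟩, hj1⟩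
  have hbdd : BddAbove A := ⟨θ₂, fun τ hτ => hτ.1.2⟩
  set r := sSup A with hr
  have hr1 : θ₁ ≤ r := le_csSup hbdd ⟨⟨le_rfl, h12.le⟩, hj1⟩
  have hr2 : r ≤ θ₂ := csSup_le hne fun τ hτ => hτ.1.2
  -- `A ⊆ Z_j ∩ I_j`
  have hAZ : A ⊆ {τ | fold a b j τ = L a b j τ} := fun τ hτ => fold_eq_of_lab_eq a b hτ.2
  have hAI : A ⊆ I a b n j := fun τ hτ => hτ.2 ▸ mem_I_lab a b n τ
  have hrcl : r ∈ closure A := csSup_mem_closure hne hbdd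
  have hrZ : fold a b j r = L a b j r :=
    (closure_minimal hAZ (isClosed_Z a b j)) hrcl
  have hrT : r ∈ T a b n j := closure_I_subset_T a b n j (closure_mono hAI hrcl)
  -- approximation from inside `A`
  have happrox : ∀ ε > 0, ∃ τ ∈ A, r - ε < τ := fun ε hε =>
    exists_lt_of_lt_csSup hne (by linarith)
  have hmemB : ∀ {i : ℕ}, i ≤ n → ∀ x, x ∈ endpts a b n i → x ∈ B a b n := by
    intro i hi x hx
    exact Finset.mem_biUnion.mpr ⟨i, Finset.mem_range.mpr (Nat.lt_succ_of_le hi), hx⟩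
  refine ⟨?_, hr1, hr2⟩
  by_cases hrI : r ∈ I a b n j
  · -- Case 2: `r ∈ I_j`, hence the active index at `r` is `j`
    have hlr : lab a b n r = j := lab_eq_of a b hjn hrZ hrI
    have hrlt : r < θ₂ := lt_of_le_of_ne hr2 fun h => hj2 (h ▸ hlr)
    obtain ⟨ε, hε, hball⟩ := Metric.isOpen_iff.mp (isOpen_I a b n j) r hrI
    -- points just right of `r` have a different active index, hence `fold j ≠ L j` there
    have hright : ∀ τ, r < τ → τ < r + ε → τ < θ₂ → fold a b j τ ≠ L a b j τ := by
      intro τ h1 h2 h3 h4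
      have hτI : τ ∈ I a b n j := hball (by rw [Metric.mem_ball, Real.dist_eq, abs_lt]; constructor <;> linarith)
      have h5 : lab a b n τ = j := lab_eq_of a b hjn h4 hτI
      have h6 : τ ∈ A := ⟨⟨by linarith, h3.le⟩, h5⟩
      have h7 : τ ≤ r := le_csSup hbdd h6
      linarith
    -- `j = 0` is impossible (the fold at level 0 is always `L 0`)
    rcases Nat.eq_zero_or_pos j with hj0 | hjpos
    · exfalso
      have hτ := hright (r + min ε (θ₂ - r) / 2) (by
          have : 0 < min ε (θ₂ - r) := lt_min hε (by linarith)
          linarith)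
        (by linarith [min_le_left ε (θ₂ - r)]) (by linarith [min_le_right ε (θ₂ - r)])
      rw [hj0] at hτ
      exact hτ rfl
    obtain ⟨j', rfl⟩ : ∃ j', j = j' + 1 := ⟨j - 1, (Nat.succ_pred_eq_of_pos hjpos).symm⟩
    -- one level down the fold equals `L (j'+1) r` at `r`
    have hdown : fold a b j' r = L a b (j' + 1) r := by
      -- at `r`: weak inequality from `fold (j'+1) r = L (j'+1) r`; right of `r`: strict the other way
      have hg : Continuous fun τ => fold a b j' τ - L a b (j' + 1) τ :=
        (continuous_fold a b j').sub (continuous_L a b (j' + 1))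
      have hweak : (if Even (j' + 1) then L a b (j' + 1) r ≤ fold a b j' r else fold a b j' r ≤ L a b (j' + 1) r) := by
        have h := hrZ
        rw [fold_succ] at h
        split_ifs at h ⊢ with he
        · exact h ▸ min_le_right _ _
        · exact h ▸ le_max_right _ _
      have hstrict : ∀ τ, r < τ → τ < r + ε → τ < θ₂ →
          (if Even (j' + 1) then 0 < L a b (j' + 1) τ - fold a b j' τ else 0 < fold a b j' τ - L a b (j' + 1) τ) := by
        intro τ h1 h2 h3
        have h4 := dom_of_fold_succ_ne a b (hright τ h1 h2 h3)
        unfold gap at h4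
        split_ifs at h4 ⊢ with he
        · exact h4
        · exact h4
      by_contra hne'
      -- the continuous function `fold j' - L (j'+1)` has a strict sign at `r`, contradicting the other strict sign nearby
      by_cases he : Even (j' + 1)
      · rw [if_pos he] at hweak
        simp only [if_pos he] at hstrict
        have hpos : 0 < fold a b j' r - L a b (j' + 1) r := by
          rcases lt_or_eq_of_le hweak with h | h
          · linarith
          · exact absurd h.symm hne'
        obtain ⟨δ, hδ, hδball⟩ := Metric.eventually_nhds_iff.mp
          ((hg.tendsto r).eventually (lt_mem_nhds hpos))
        set τ := r + min (min ε δ) (θ₂ - r) / 2 with hτ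
        have hm : 0 < min (min ε δ) (θ₂ - r) := lt_min (lt_min hε hδ) (by linarith)
        have h1 : r < τ := by rw [hτ]; linarith
        have h2 : τ < r + ε := by
          have := min_le_left (min ε δ) (θ₂ - r); have := min_le_left ε δ; rw [hτ]; linarith
        have h3 : τ < θ₂ := by have := min_le_right (min ε δ) (θ₂ - r); rw [hτ]; linarith
        have h4 : dist τ r < δ := by
          have := min_le_left (min ε δ) (θ₂ - r); have := min_le_right ε δ
          rw [Real.dist_eq, abs_lt]
          exact ⟨by rw [hτ]; linarith, by rw [hτ]; linarith⟩
        have h5 := hδball h4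
        have h6 := hstrict τ h1 h2 h3
        linarith
      · rw [if_neg he] at hweak
        simp only [if_neg he] at hstrict
        have hneg : fold a b j' r - L a b (j' + 1) r < 0 := by
          rcases lt_or_eq_of_le hweak with h | h
          · linarith
          · exact absurd h hne'
        obtain ⟨δ, hδ, hδball⟩ := Metric.eventually_nhds_iff.mp
          ((hg.tendsto r).eventually (gt_mem_nhds hneg))
        set τ := r + min (min ε δ) (θ₂ - r) / 2 with hτ
        have hm : 0 < min (min ε δ) (θ₂ - r) := lt_min (lt_min hε hδ) (by linarith)
        have h1 : r < τ := by rw [hτ]; linarith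
        have h2 : τ < r + ε := by
          have := min_le_left (min ε δ) (θ₂ - r); have := min_le_left ε δ; rw [hτ]; linarith
        have h3 : τ < θ₂ := by have := min_le_right (min ε δ) (θ₂ - r); rw [hτ]; linarith
        have h4 : dist τ r < δ := by
          have := min_le_left (min ε δ) (θ₂ - r); have := min_le_right ε δ
          rw [Real.dist_eq, abs_lt]
          exact ⟨by rw [hτ]; linarith, by rw [hτ]; linarith⟩
        have h5 := hδball h4
        have h6 := hstrict τ h1 h2 h3
        linarith
    -- the active index one level down
    set i := lab a b j' r with hi
    have hij : i ≤ j' := lab_le a b j' r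
    have hLi : L a b i r = L a b (j' + 1) r := (fold_eq_lab a b j' r).symm.trans hdown
    -- `r ∈ T_i`
    have hrTi : r ∈ T a b n i := by
      intro t h1 h2
      rcases lt_trichotomy t (j' + 1) with h3 | h3 | h3
      · -- `i < t ≤ j'`: strict placement one level down
        have h4 := dom_of_lab_lt a b (k := j') h1 (Nat.lt_succ_iff.mp h3)
        rw [← hi] at h4
        exact h4.le
      · -- `t = j'+1`: equality
        rw [h3]; unfold gap
        split_ifs <;> linarith
      · -- `j'+1 < t ≤ n`: strict placement w.r.t. `L (j'+1) r = L i r` from `lab n r = j'+1`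
        have h4 := dom_of_lab_lt a b (k := n) (hlr.symm ▸ h3) h2
        rw [hlr] at h4
        rw [hLi]
        exact h4.le
    -- `r` is an endpoint of the interval `T_i`: otherwise `L i = L (j'+1)` as functions
    have hend : r = sInf (T a b n i) ∨ r = sSup (T a b n i) := by
      refine eq_sInf_or_eq_sSup_of_mem hrTi ?_
      rintro ⟨y₁, hy₁, y₂, hy₂, h1, h2⟩
      have hj't : i < j' + 1 := Nat.lt_succ_of_le hij
      have g1 := hy₁ (j' + 1) hj't hjn
      have g2 := hy₂ (j' + 1) hj't hjn
      unfold gap at g1 g2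
      unfold L at g1 g2 hLi
      -- from weak placement at `y₁`, `y₂` and equality at `r` strictly between: slopes and intercepts agree
      have hcoef : a i = a (j' + 1) ∧ b i = b (j' + 1) := by
        -- `p := a i - a (j'+1)`, `q := b i - b (j'+1)`: `p r + q = 0`, and `p y + q` has one weak sign at `y₁ < r < y₂`
        have hp0 : a i - a (j' + 1) = 0 := by
          by_contra hp
          rcases lt_or_gt_of_ne hp with hp | hp
          · split_ifs at g1 g2 with he
            · have e2 : (a i - a (j' + 1)) * (y₂ - r) ≤ 0 := by nlinarith
              have : 0 < (a i - a (j' + 1)) * (y₁ - r) := mul_pos_of_neg_of_neg hp (by linarith)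
              have e1 : (a i - a (j' + 1)) * (y₁ - r) ≤ 0 := by nlinarith
              linarith
            · have e1 : 0 ≤ (a i - a (j' + 1)) * (y₁ - r) := by nlinarith
              have e2 : 0 ≤ (a i - a (j' + 1)) * (y₂ - r) := by nlinarith
              have : (a i - a (j' + 1)) * (y₂ - r) < 0 := mul_neg_of_neg_of_pos hp (by linarith)
              linarith
          · split_ifs at g1 g2 with he
            · have e2 : (a i - a (j' + 1)) * (y₂ - r) ≤ 0 := by nlinarith
              have : 0 < (a i - a (j' + 1)) * (y₂ - r) := mul_pos hp (by linarith)
              linarith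
            · have e1 : 0 ≤ (a i - a (j' + 1)) * (y₁ - r) := by nlinarith
              have : (a i - a (j' + 1)) * (y₁ - r) < 0 := mul_neg_of_pos_of_neg hp (by linarith)
              linarith
        have ha : a i = a (j' + 1) := by linarith
        refine ⟨ha, ?_⟩
        rw [ha] at hLi
        linarith
      rcases hd i (j' + 1) hj't hjn with h | h
      · exact h hcoef.1
      · exact h hcoef.2
    have hin : i ≤ n := hij.trans ((Nat.le_succ j').trans hjn)
    rcases hend with h | h
    · exact hmemB hin _ (by unfold endpts; simp [h])
    · exact hmemB hin _ (by unfold endpts; simp [h])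
  · -- Case 1: `r ∉ I_j`: then `r = sSup I_j`
    have hub : ∀ y ∈ I a b n j, y ≤ r := by
      intro y hy
      by_contra h
      obtain ⟨τ, hτ, _⟩ := happrox 1 one_pos
      have hτr : τ ≤ r := le_csSup hbdd hτ
      exact hrI ((ordConnected_I a b n j).out (hAI hτ) hy ⟨hτr, (lt_of_not_ge h).le⟩)
    have hlub : IsLUB (I a b n j) r := by
      refine ⟨hub, fun x hx => ?_⟩
      by_contra h
      obtain ⟨τ, hτ, hτ'⟩ := happrox (r - x) (by linarith [lt_of_not_ge h])
      have := hx (hAI hτ)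
      linarith
    have hIne : (I a b n j).Nonempty := ⟨θ₁, hj1 ▸ mem_I_lab a b n θ₁⟩
    have hsup : sSup (I a b n j) = r := hlub.csSup_eq hIne
    exact hmemB hjn _ (by unfold endpts; simp [hsup])

/-! ## 4. Counting the changes of the active index -/

/-- **THE FOLD LEMMA (degeneracy-free P2).**  For `n + 1` pairwise-distinct lines, along any strictly increasing
sequence `θ_0 < θ_1 < ⋯ < θ_N` at which consecutive active indices of the alternating fold differ, `N ≤ 8 n + 9`. -/
theorem card_changes_le (n : ℕ) (hd : ∀ i j, i < j → j ≤ n → (a i ≠ a j ∨ b i ≠ b j)) (N : ℕ)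
    (θs : Fin (N + 1) → ℝ) (hθ : StrictMono θs)
    (hch : ∀ e : Fin N, lab a b n (θs e.castSucc) ≠ lab a b n (θs e.succ)) : N ≤ 8 * n + 9 := by
  -- run suprema
  let r : Fin N → ℝ := fun e => sSup {τ | τ ∈ Icc (θs e.castSucc) (θs e.succ) ∧ lab a b n τ = lab a b n (θs e.castSucc)}
  have hr : ∀ e : Fin N, r e ∈ B a b n ∧ θs e.castSucc ≤ r e ∧ r e ≤ θs e.succ := fun e =>
    sSup_run_mem a b n hd (hθ (Fin.castSucc_lt_succ : e.castSucc < e.succ)) rfl (hch e).symm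
  -- even-indexed run suprema are strictly increasing
  let M := N / 2
  have hM : ∀ e : Fin M, 2 * (e : ℕ) < N := fun e => by have := e.isLt; omega
  let g : Fin M → ℝ := fun e => r ⟨2 * e, hM e⟩
  have hg : StrictMono g := by
    intro e e' hlt
    have h1 : 2 * (e : ℕ) + 2 ≤ 2 * (e' : ℕ) := by have : (e : ℕ) < e' := hlt; omega
    -- r(2e) ≤ θ(2e+1) < θ(2e+2) ≤ θ(2e') ≤ r(2e')
    have h2 := (hr ⟨2 * e, hM e⟩).2.2
    have h3 := (hr ⟨2 * e', hM e'⟩).2.1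
    have h4 : θs (Fin.succ ⟨2 * e, hM e⟩) < θs (Fin.castSucc ⟨2 * e', hM e'⟩) := by
      apply hθ
      rw [Fin.lt_def]
      simp only [Fin.val_succ, Fin.val_castSucc]
      omega
    show r ⟨2 * e, hM e⟩ < r ⟨2 * e', hM e'⟩
    linarith
  have hinj : Function.Injective g := hg.injective
  have hcard : M ≤ (B a b n).card := by
    have h1 : (Finset.univ.image g).card = M := by
      rw [Finset.card_image_of_injective _ hinj, Finset.card_univ, Fintype.card_fin]
    rw [← h1]
    exact Finset.card_le_card fun x hx => by
      obtain ⟨e, _, rfl⟩ := Finset.mem_image.mp hx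
      exact (hr _).1
  have h2 := card_B_le a b n
  omega

end

end StaticPathFold

end Summit.ValiantsHypothesis.ValiantsHypothesis.Theorems.KPlusLogSqLaw
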